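import Mathlib
import Literature.Analysis.FluidPDE.AxisymHouLiVariables
import Literature.Analysis.FluidPDE.AxisymQuotientEquationsOmega
import Literature.Analysis.FluidPDE.HouLiSpaceTime
import Literature.Analysis.FluidPDE.AxisymTransportIBP
import Literature.Analysis.FluidPDE.ClassicalSolutionGlue
import Literature.Analysis.FluidPDE.EnergyToolkit
import Literature.Analysis.FluidPDE.MildSolutionProofs
import Literature.Analysis.FluidPDE.WholeSpaceIBP
import HarnessLib

/-!
# Conservation of `‖ω_θ/r‖_{L²}` along classical axisymmetric swirl-free EULER flows on `(−∞, 0)`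
# (helper of the axisymmetric swirl-free DSS stratum of the crux `EulerZoomLiouville.PowerGaugeEulerLiouville`,
# route №10, item stmt-NavierStokesRegularity-19832)

Helper file (theorems only; `--supports stmt-NavierStokesRegularity-19832`). Seat ns-typeII-p3 (cell
ns-regularity-ideate §B, D-0081), rungs C2 ∩ C3 / C1 ∩ C3 of `Cruxes/PowerGaugeEulerLiouville/Lines/rungC_window.lean`.

THE LEMMA (Ukhovskii–Yudovich 1968 / Majda–Bertozzi §4.3 (4.60): `D/Dt (ω^θ/r) = 0` for inviscid
axisymmetric flows without swirl). Let `(u, p)` be a CLASSICAL Euler solution on the open slab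
`(−∞, 0) × ℝ³` (`IsClassicalNSSolutionOn (Iio 0) 0 0 u p`) with axisymmetric swirl-free slices, and let
`η(τ) = angVortQuot (u τ) = ω_θ/r` (the tree's smooth radial quotient). If on a compact time interval
`[s, t] ⊂ (−∞, 0)` the velocity and its gradient are bounded and `η(τ) ∈ L²(ℝ³)` with `∫ η(τ)² ≤ N`, then
**`∫ η(t)² dy = ∫ η(s)² dy`** (`integral_angVortQuot_sq_eq_of_classical`).

THE PROOF. Shift time to `[0, T]`, `T = t − s` (`IsClassicalNSSolutionOn.comp_add_right/.mono`). The
tree's `Ω`-equation (`IsClassicalNSSolutionOn.angVortQuot_eq`, Lei–Zhang (1.4)₂) at `ν = 0` and zero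
swirl reads `∂ₜη + Dη[u] = 0` pointwise (`timeDerivWithin_angVortQuot_eq_neg`). Against the smooth cut-off
`χ_R = cutoff R` the tree's time-integration identity
(`IsSmoothSpaceTimeOn.integral_Ioo_integral_mul_timeDerivWithin_mul`) gives
`½∫χ_R η(T)² − ½∫χ_R η(0)² = ∫₀ᵀ∫ χ_R η ∂ₜη = −½∫₀ᵀ∫ χ_R D(η²)[u] = ½∫₀ᵀ∫ Dχ_R[u] η²` (transport
integration by parts, `integral_mul_fderiv_apply_eq_neg_of_isDivFree'`, `div u = 0`), and
`|½∫ Dχ_R[u] η²| ≤ C B N / (2R)`; letting `R = n + 1 → ∞` (`tendsto_integral_cutoff_mul`) yields the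
claim. Only the velocity bound enters the flux; the gradient bound is a hypothesis of the tree's
integration-by-parts lemma.

WHAT THIS IS NOT: not NS, not the crux — a conservation law for classical swirl-free Euler flows, the
transport lever of the DSS stratum (sequel `…AxisymNoSwirlDSS.lean`). [folklore]
-/

noncomputable section

-- the summit and its single problem share the name `NavierStokesRegularity` (D-0017 nested layout)
set_option linter.dupNamespace false

open Set Function Filter Topology MeasureTheory Metric
open scoped NNReal ENNReal InnerProductSpace RealInnerProductSpace

namespace Summit.NavierStokesRegularity.NavierStokesRegularity.Theorems.PowerGaugeEulerLiouville.AxisymNoSwirl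

open Literature.Analysis Literature.Analysis.FluidPDE

/-! ## Pointwise transport of `η = ω_θ/r` -/

/-- Without swirl `u^θ/r ≡ 0`: `angVelQuot v = 0` when `swirl v ≡ 0` (copy of the tree's private
lemma in `AxisymNoSwirlCoSignedFlux`). [folklore] -/
theorem angVelQuot_eq_zero_of_hasNoSwirl {v : (EuclideanSpace ℝ (Fin 3)) → (EuclideanSpace ℝ (Fin 3))}
    (hsw : HasNoSwirl v) : angVelQuot v = 0 := by
  have h0 : swirl v = fun _ => 0 := funext fun x => hsw x
  funext x
  simp only [angVelQuot, h0, Pi.zero_apply]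
  have h1 : radDerivQuot (fun _ : (EuclideanSpace ℝ (Fin 3)) => (0 : ℝ)) = fun _ => 0 := by
    funext y
    simp [radDerivQuot, hadamardQuotFst]
  simp [radQuot, h1]

/-- **`∂ₜη = −Dη[u]`** for a classical swirl-free axisymmetric EULER flow on `[0, T]`, `T > 0`
(the tree's `Ω`-equation `IsClassicalNSSolutionOn.angVortQuot_eq` at `ν = 0`, `u^θ ≡ 0`, and
`∂ₜ angVortQuot = angVortQuot ∂ₜ`). [folklore] -/
theorem timeDerivWithin_angVortQuot_eq_neg {T : ℝ} (hT : 0 < T)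
    {v : ℝ → (EuclideanSpace ℝ (Fin 3)) → (EuclideanSpace ℝ (Fin 3))} {q : ℝ → (EuclideanSpace ℝ (Fin 3)) → ℝ}
    (hv : IsClassicalNSSolutionOn (Icc 0 T) 0 0 v q)
    (hax : ∀ σ ∈ Icc 0 T, IsAxisymmetric (v σ)) (hsw : ∀ σ ∈ Icc 0 T, HasNoSwirl (v σ))
    {σ : ℝ} (hσ : σ ∈ Icc 0 T) (x : (EuclideanSpace ℝ (Fin 3))) :
    FluidPDE.timeDerivWithin (Icc 0 T) (fun s => angVortQuot (v s)) σ x =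
      -(fderiv ℝ (angVortQuot (v σ)) x (v σ x)) := by
  have hS : UniqueDiffOn ℝ (Icc 0 T) := uniqueDiffOn_Icc hT
  have hcl : Icc 0 T ⊆ closure (interior (Icc 0 T)) := by
    rw [interior_Icc, closure_Ioo hT.ne]
  have h1 := hv.smooth_velocity.timeDerivWithin_angVortQuot (convex_Icc 0 T) hS hcl hax hσ x
  have h2 := hv.angVortQuot_eq hS hcl hax hσ x
  rw [angVelQuot_eq_zero_of_hasNoSwirl (hsw σ hσ)] at h2
  simp only [zero_mul, Pi.zero_apply, mul_zero, sub_zero] at h2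
  rw [h1]
  linarith

/-! ## The cut-off flux -/

/-- **The localized slice identity**: for a classical swirl-free axisymmetric Euler flow on `[0, T]`
with bounded velocity and velocity gradient at time `σ`, and the cut-off `χ = cutoff R`,
`∫ χ (∂ₜη · η) = ½ ∫ Dχ[u] η²` (transport + integration by parts with `div u = 0`). [folklore] -/
theorem integral_cutoff_mul_timeDerivWithin_mul_eq {T : ℝ} (hT : 0 < T)
    {v : ℝ → (EuclideanSpace ℝ (Fin 3)) → (EuclideanSpace ℝ (Fin 3))} {q : ℝ → (EuclideanSpace ℝ (Fin 3)) → ℝ}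
    (hv : IsClassicalNSSolutionOn (Icc 0 T) 0 0 v q)
    (hax : ∀ σ ∈ Icc 0 T, IsAxisymmetric (v σ)) (hsw : ∀ σ ∈ Icc 0 T, HasNoSwirl (v σ))
    {σ : ℝ} (hσ : σ ∈ Icc 0 T) {B : ℝ} (hB : ∀ y, ‖v σ y‖ ≤ B ∧ ‖fderiv ℝ (v σ) y‖ ≤ B)
    {R : ℝ} (hR : 0 < R) :
    ∫ x, cutoff R x * (FluidPDE.timeDerivWithin (Icc 0 T) (fun s => angVortQuot (v s)) σ x *
        angVortQuot (v σ) x) =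
      2⁻¹ * ∫ x, fderiv ℝ (cutoff R) x (v σ x) * angVortQuot (v σ) x ^ 2 := by
  set W : (EuclideanSpace ℝ (Fin 3)) → ℝ := angVortQuot (v σ) with hWdef
  have hvs := hv.contDiff_velocity hσ
  have hv1 : ContDiff ℝ 1 (v σ) := hvs.of_le (by norm_cast)
  have hv4 : ContDiff ℝ 4 (v σ) := hvs.of_le (by norm_cast)
  have hW1 : ContDiff ℝ 1 W := contDiff_angVortQuot (n := 1) hv4
  have hW2 : ContDiff ℝ 1 (fun y => W y ^ 2) := hW1.pow 2
  have hχ : ContDiff ℝ 1 (cutoff (E := (EuclideanSpace ℝ (Fin 3))) R) := contDiff_cutoff R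
  have hχc : HasCompactSupport (cutoff (E := (EuclideanSpace ℝ (Fin 3))) R) := hasCompactSupport_cutoff hR
  -- pointwise: `∂ₜη η = -½ D(η²)[u]`
  have hpt : ∀ x, cutoff R x * (FluidPDE.timeDerivWithin (Icc 0 T) (fun s => angVortQuot (v s)) σ x * W x) =
      -(2⁻¹) * (cutoff R x * fderiv ℝ (fun y => W y ^ 2) x (v σ x)) := by
    intro x
    rw [timeDerivWithin_angVortQuot_eq_neg hT hv hax hsw hσ x]
    have hd : fderiv ℝ (fun y => W y ^ 2) x (v σ x) = 2 * W x * fderiv ℝ W x (v σ x) := by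
      have hWx : DifferentiableAt ℝ W x := (hW1.differentiable one_ne_zero) x
      rw [show (fun y => W y ^ 2) = W ^ 2 from rfl, fderiv_pow _ hWx]
      simp [pow_one]
    rw [hd]
    ring
  rw [integral_congr_ae (Eventually.of_forall hpt), integral_const_mul]
  -- integration by parts `∫ χ D(η²)[u] = -∫ Dχ[u] η²`
  have hcW2 : Continuous fun y => W y ^ 2 := hW2.continuous
  have hab : Integrable (fun x => cutoff R x * W x ^ 2) :=
    (hχ.continuous.mul hcW2).integrable_of_hasCompactSupport (hχc.mul_right)
  have hDab : ∀ i : Fin 3, Integrable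
      (fun x => fderiv ℝ (cutoff R) x (EuclideanSpace.single i 1) * W x ^ 2) := fun i => by
    refine Continuous.integrable_of_hasCompactSupport ?_ ?_
    · exact ((hχ.continuous_fderiv one_ne_zero).clm_apply continuous_const).mul hcW2
    · exact (hχc.fderiv_apply (𝕜 := ℝ) (EuclideanSpace.single i 1)).mul_right
  have haDb : ∀ i : Fin 3, Integrable
      (fun x => cutoff R x * fderiv ℝ (fun y => W y ^ 2) x (EuclideanSpace.single i 1)) := fun i => by
    refine Continuous.integrable_of_hasCompactSupport ?_ hχc.mul_right
    exact hχ.continuous.mul ((hW2.continuous_fderiv one_ne_zero).clm_apply continuous_const)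
  have hibp := integral_mul_fderiv_apply_eq_neg_of_isDivFree' hχ hW2 hv1 (hv.divFree σ hσ)
    (fun y => (hB y).1) (fun y => (hB y).2) hab hDab haDb
  rw [hibp]
  ring

/-- **The flux bound**: `|∫ Dχ_R[u] η²| ≤ (C/R) · B · N` when `‖D χ_R‖ ≤ C/R`, `‖u‖ ≤ B`, `∫ η² ≤ N`.
[folklore] -/
theorem abs_integral_fderiv_cutoff_mul_sq_le {w : (EuclideanSpace ℝ (Fin 3)) → (EuclideanSpace ℝ (Fin 3))}
    {W : (EuclideanSpace ℝ (Fin 3)) → ℝ} {B N C R : ℝ}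
    (hC : ∀ x : (EuclideanSpace ℝ (Fin 3)), ‖fderiv ℝ (cutoff R) x‖ ≤ C / R)
    (hB : ∀ y, ‖w y‖ ≤ B) (hint : Integrable (fun y => W y ^ 2)) (hN : ∫ y, W y ^ 2 ≤ N) :
    |∫ x, fderiv ℝ (cutoff R) x (w x) * W x ^ 2| ≤ C / R * B * N := by
  have hC0 : 0 ≤ C / R := (norm_nonneg _).trans (hC 0)
  have hB0 : 0 ≤ B := (norm_nonneg _).trans (hB 0)
  have hpt : ∀ x, ‖fderiv ℝ (cutoff R) x (w x) * W x ^ 2‖ ≤ C / R * B * W x ^ 2 := by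
    intro x
    rw [norm_mul, Real.norm_of_nonneg (sq_nonneg _)]
    gcongr
    calc ‖fderiv ℝ (cutoff R) x (w x)‖ ≤ ‖fderiv ℝ (cutoff R) x‖ * ‖w x‖ :=
          (fderiv ℝ (cutoff R) x).le_opNorm _
      _ ≤ C / R * B := by gcongr; exacts [hC x, hB x]
  have h1 : ‖∫ x, fderiv ℝ (cutoff R) x (w x) * W x ^ 2‖ ≤ ∫ x, C / R * B * W x ^ 2 :=
    norm_integral_le_of_norm_le (hint.const_mul _) (Eventually.of_forall hpt)
  rw [Real.norm_eq_abs, integral_const_mul] at h1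
  exact h1.trans (by gcongr)

/-! ## Conservation on `[0, T]` and on `(−∞, 0)` -/

/-- **Conservation of `∫ η²` on `[0, T]`** for a classical swirl-free axisymmetric Euler flow with
bounded velocity / velocity gradient and square-integrable `η` (bound `N`) on `[0, T]`. [folklore] -/
theorem integral_angVortQuot_sq_eq_of_Icc {T : ℝ} (hT : 0 < T)
    {v : ℝ → (EuclideanSpace ℝ (Fin 3)) → (EuclideanSpace ℝ (Fin 3))} {q : ℝ → (EuclideanSpace ℝ (Fin 3)) → ℝ}
    (hv : IsClassicalNSSolutionOn (Icc 0 T) 0 0 v q)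
    (hax : ∀ σ ∈ Icc 0 T, IsAxisymmetric (v σ)) (hsw : ∀ σ ∈ Icc 0 T, HasNoSwirl (v σ))
    {B : ℝ} (hB : ∀ σ ∈ Icc 0 T, ∀ y, ‖v σ y‖ ≤ B ∧ ‖fderiv ℝ (v σ) y‖ ≤ B)
    {N : ℝ} (hN : ∀ σ ∈ Icc 0 T, Integrable (fun y => angVortQuot (v σ) y ^ 2) ∧
      ∫ y, angVortQuot (v σ) y ^ 2 ≤ N) :
    ∫ y, angVortQuot (v T) y ^ 2 = ∫ y, angVortQuot (v 0) y ^ 2 := by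
  obtain ⟨C, hC0, hC⟩ := exists_norm_fderiv_cutoff_le (E := (EuclideanSpace ℝ (Fin 3)))
  have hS : UniqueDiffOn ℝ (Icc 0 T) := uniqueDiffOn_Icc hT
  have hWfam : IsSmoothSpaceTimeOn (Icc 0 T) (fun s => angVortQuot (v s)) :=
    hv.smooth_velocity.angVortQuot_family (convex_Icc 0 T) hS
  -- the localized balance at scale `R = n + 1`, bounded by `T · C B N / (2 (n+1))`
  have hloc : ∀ n : ℕ, |2⁻¹ * (∫ x, cutoff ((n : ℝ) + 1) x * angVortQuot (v T) x ^ 2) -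
      2⁻¹ * (∫ x, cutoff ((n : ℝ) + 1) x * angVortQuot (v 0) x ^ 2)| ≤
      C / ((n : ℝ) + 1) * B * N * 2⁻¹ * T := by
    intro n
    have hR : (0 : ℝ) < (n : ℝ) + 1 := by positivity
    have hbal := hWfam.integral_Ioo_integral_mul_timeDerivWithin_mul hT
      (contDiff_cutoff (n := 0) ((n : ℝ) + 1)).continuous (hasCompactSupport_cutoff hR)
      (s := 0) (t := T) le_rfl hT.le le_rfl
    rw [← hbal]
    have hinner : ∀ σ ∈ Ioo 0 T, ‖∫ x, cutoff ((n : ℝ) + 1) x *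
        (FluidPDE.timeDerivWithin (Icc 0 T) (fun s => angVortQuot (v s)) σ x * angVortQuot (v σ) x)‖ ≤
        C / ((n : ℝ) + 1) * B * N * 2⁻¹ := by
      intro σ hσ
      have hσ' : σ ∈ Icc 0 T := Ioo_subset_Icc_self hσ
      rw [integral_cutoff_mul_timeDerivWithin_mul_eq hT hv hax hsw hσ' (hB σ hσ') hR, Real.norm_eq_abs,
        abs_mul, abs_of_pos (by norm_num : (0 : ℝ) < 2⁻¹)]
      have := abs_integral_fderiv_cutoff_mul_sq_le (hC _ hR) (fun y => (hB σ hσ' y).1)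
        (hN σ hσ').1 (hN σ hσ').2
      nlinarith
    have h := norm_setIntegral_le_of_norm_le_const (μ := volume) (s := Ioo 0 T)
      (by simp) hinner
    rw [Real.norm_eq_abs, Real.volume_real_Ioo_of_le hT.le, sub_zero] at h
    exact h
  -- the limits `R → ∞`
  have hlimT := tendsto_integral_cutoff_mul (hN T ⟨hT.le, le_rfl⟩).1
  have hlim0 := tendsto_integral_cutoff_mul (hN 0 ⟨le_rfl, hT.le⟩).1
  have hlim : Tendsto (fun n : ℕ => 2⁻¹ * (∫ x, cutoff ((n : ℝ) + 1) x * angVortQuot (v T) x ^ 2) -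
      2⁻¹ * (∫ x, cutoff ((n : ℝ) + 1) x * angVortQuot (v 0) x ^ 2)) atTop
      (𝓝 (2⁻¹ * (∫ x, angVortQuot (v T) x ^ 2) - 2⁻¹ * (∫ x, angVortQuot (v 0) x ^ 2))) :=
    (hlimT.const_mul _).sub (hlim0.const_mul _)
  have hbound : Tendsto (fun n : ℕ => C / ((n : ℝ) + 1) * B * N * 2⁻¹ * T) atTop (𝓝 0) := by
    have h1 : Tendsto (fun n : ℕ => C / ((n : ℝ) + 1)) atTop (𝓝 0) :=
      tendsto_const_nhds.div_atTop (tendsto_natCast_atTop_atTop.atTop_add tendsto_const_nhds)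
    simpa using ((h1.mul_const B).mul_const N).mul_const 2⁻¹ |>.mul_const T
  have hzero : Tendsto (fun n : ℕ => 2⁻¹ * (∫ x, cutoff ((n : ℝ) + 1) x * angVortQuot (v T) x ^ 2) -
      2⁻¹ * (∫ x, cutoff ((n : ℝ) + 1) x * angVortQuot (v 0) x ^ 2)) atTop (𝓝 0) :=
    squeeze_zero_norm (fun n => by rw [Real.norm_eq_abs]; exact hloc n) hbound
  have heq := tendsto_nhds_unique hlim hzero
  linarith

/-- **Conservation of `‖ω_θ/r‖₂` along a classical axisymmetric swirl-free Euler flow on `(−∞, 0)`**: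
for `(u, p)` classical on the open slab with axisymmetric swirl-free slices, and `s < t < 0` such that
on `[s, t]` the velocity and its gradient are bounded by `B` and `η(τ) = angVortQuot (u τ) ∈ L²` with
`∫ η(τ)² ≤ N`, one has `∫ η(t)² = ∫ η(s)²` (Ukhovskii–Yudovich; Majda–Bertozzi §4.3 (4.60)). [folklore] -/
theorem integral_angVortQuot_sq_eq_of_classical
    {u : ℝ → (EuclideanSpace ℝ (Fin 3)) → (EuclideanSpace ℝ (Fin 3))} {p : ℝ → (EuclideanSpace ℝ (Fin 3)) → ℝ}
    (hns : IsClassicalNSSolutionOn (Iio 0) 0 0 u p)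
    (hax : ∀ τ : ℝ, τ < 0 → IsAxisymmetric (u τ)) (hsw : ∀ τ : ℝ, τ < 0 → HasNoSwirl (u τ))
    {s t : ℝ} (hst : s < t) (ht : t < 0)
    {B : ℝ} (hB : ∀ τ ∈ Icc s t, ∀ y, ‖u τ y‖ ≤ B ∧ ‖fderiv ℝ (u τ) y‖ ≤ B)
    {N : ℝ} (hN : ∀ τ ∈ Icc s t, Integrable (fun y => angVortQuot (u τ) y ^ 2) ∧
      ∫ y, angVortQuot (u τ) y ^ 2 ≤ N) :
    ∫ y, angVortQuot (u t) y ^ 2 = ∫ y, angVortQuot (u s) y ^ 2 := by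
  set T : ℝ := t - s with hTdef
  have hT : 0 < T := sub_pos.2 hst
  -- the shifted solution on `[0, T]`
  have hsub : Icc 0 T ⊆ (fun σ : ℝ => σ + s) ⁻¹' Iio (0 : ℝ) := by
    intro σ hσ
    show σ + s < 0
    have := hσ.2; rw [hTdef] at this; linarith
  have hmem : ∀ σ ∈ Icc 0 T, σ + s ∈ Icc s t := fun σ hσ =>
    ⟨by linarith [hσ.1], by have := hσ.2; rw [hTdef] at this; linarith⟩
  have hv : IsClassicalNSSolutionOn (Icc 0 T) 0 0 (fun σ => u (σ + s)) (fun σ => p (σ + s)) :=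
    (hns.comp_add_right s).mono hsub (uniqueDiffOn_Icc hT)
  have h := integral_angVortQuot_sq_eq_of_Icc hT hv
    (fun σ hσ => hax (σ + s) (hsub hσ)) (fun σ hσ => hsw (σ + s) (hsub hσ))
    (fun σ hσ => hB (σ + s) (hmem σ hσ)) (fun σ hσ => hN (σ + s) (hmem σ hσ))
  simp only [hTdef, sub_add_cancel, zero_add] at h
  exact h

end Summit.NavierStokesRegularity.NavierStokesRegularity.Theorems.PowerGaugeEulerLiouville.AxisymNoSwirl

end
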